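import Mathlib
import HarnessLib
import HarnessLib.Audit
import Summits.CriticalPhenomena.Statement

/-!
Route: PercMonotoneFactors

DORMANT since 2026-09-01T19:10:33Z (reconciler: no traction for 5 d (last activity statement-checked at 2026-08-27T18:30:42Z); parked, not closed — `ledger route dormant route-CriticalPhenomena-PercMonotoneFactors --off` to reactivate) — unstaffed, not closed; items shared with open routes are served there. `ledger route dormant <id> --off` reactivates.

# Route PercMonotoneFactors — no monotone finite-range factor of Bernoulli on Z^3 jumps at its
threshold — percolation forces local uniqueness, class-wide

Rising sea (card rising-sea-monotone-block-factors; absorbs the retired duplicate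
finitely-dependent-mixed-order). Let 𝔉₃ be the
class of ADMISSIBLE block rules on bond configurations of ℤ³: F : BondConfig(ℤ³) → BondConfig(ℤ³)
measurable, monotone, of finite
range R, equivariant under every graph automorphism of ℤ³ (translations and the 48 lattice
symmetries), with F ∅ = ∅, F E = E and
F ω ⊆ E for ω ⊆ E (E = edge set of ℤ³). The block-factor family of F is μ_t^F := law of F(ω), ω ~
Bernoulli(t), and
θ_F(t) := μ_t^F(0 ↔ ∞). It suffices to show X = ClassNoJump: for every F ∈ 𝔉₃ and every t ∈ [0,1],
if θ_F(s) = 0 for all s < t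
then θ_F(t) = 0 — no member of the class has a percolation probability that jumps from zero
(equivalently θ_F(t_c(F)) = 0).
Bernoulli bond percolation is F = id ∈ 𝔉₃, and θ = 0 below p_c is proved in tree, so X →
PercolationContinuityZ3 by pure logic
(closed sorry-free in the planner sketch). The class is the natural "short-range, positively
associated, label-driven" hull of
Bernoulli percolation: every μ_t^F is translation-invariant, R-dependent, Harris–FKG, stochastically
increasing and polynomially
continuous in t on local events, sprinkling t ↦ t + η stays inside the family, and block
renormalisations of a member are again
monotone finite-range factors of the same labels.
Lean: `∀ (R : ℕ) (F : Literature.Probability.Percolation.BondConfig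
(Literature.Probability.LatticeModels.Site 3) → Literature.Probability.Percolation.BondConfig
(Literature.Probability.LatticeModels.Site 3)), Measurable F → Monotone F → F ∅ = ∅ → F
(Literature.Probability.LatticeModels.zdGraph 3).edgeSet =
(Literature.Probability.LatticeModels.zdGraph 3).edgeSet → (∀ ω :
Literature.Probability.Percolation.BondConfig (Literature.Probability.LatticeModels.Site 3), ω ⊆
(Literature.Probability.LatticeModels.zdGraph 3).edgeSet → F ω ⊆
(Literature.Probability.LatticeModels.zdGraph 3).edgeSet) → (∀ (φ :
Literature.Probability.LatticeModels.zdGraph 3 ≃g Literature.Probability.LatticeModels.zdGraph 3) (ω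
: Literature.Probability.Percolation.BondConfig (Literature.Probability.LatticeModels.Site 3)), F
(Sym2.map φ '' ω) = Sym2.map φ '' (F ω)) → (∀ (ω ω' : Literature.Probability.Percolation.BondConfig
(Literature.Probability.LatticeModels.Site 3)) (e : Sym2 (Literature.Probability.LatticeModels.Site
3)), (∀ e' : Sym2 (Literature.Probability.LatticeModels.Site 3), (∃ x ∈ e, ∃ y ∈ e', ∀ i, |x i - y
i| ≤ (R : ℤ)) → (e' ∈ ω ↔ e' ∈ ω')) → (e ∈ F ω ↔ e ∈ F ω')) → ∀ t : unitInterval, (∀ s :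
unitInterval, s < t → ((Literature.Probability.Percolation.bondPercolation
(Literature.Probability.LatticeModels.zdGraph 3) s).map F).real
(Literature.Probability.Percolation.percolatesAt 0) = 0) →
((Literature.Probability.Percolation.bondPercolation (Literature.Probability.LatticeModels.zdGraph
3) t).map F).real (Literature.Probability.Percolation.percolatesAt 0) = 0`

## Assembly
Pure logic plus two proved facts: instantiate ClassNoJump at R = 0, F = id (measurable_id,
monotone_id, rfl, rfl, equivariance by rfl,
locality via Sym2.out_fst_mem), rewrite Measure.map_id, take t = criticalProbI 3 and discharge the
hypothesis "θ(s) = 0 for s < p_c"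
by Literature.Probability.Percolation.theta_eq_zero_of_lt_criticalProb_holds; the conclusion is
literally PercolationContinuity 3.
Closed sorry-free (axioms propext, Classical.choice, Quot.sound) in the planner's SketchProof.lean —
a prover can land it at once.
The foreseen route to ClassNoJump itself is the glue of § Two-layer plan:
PercolationForcesLocalUniqueness + LocalUniquenessCriterion +
polynomial continuity of s ↦ μ_s^F(V_n).

Rationale: WHY THIS LINE. The question "can a LOCAL monotone rule make percolation explosive on ℤ³?" sits
exactly in the gap left by every catalogued jump
mechanism (Aizenman–Newman 1/r² chains: infinite range; wired random-cluster q > Q: not a finitary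
factor, local densities jump;
critical trees / non-unimodular graphs: not ℤ³; k-core, bootstrap and the spiral model
arXiv:0709.0378: infinite-range culling), and
its mean-field analogue is a theorem — RiordanWarnke2011: merging rules that see boundedly many
vertices cannot produce a discontinuous
transition. Posing continuity for the whole class 𝔉₃ buys tools a single model does not have:
dependent-percolation theory
(LiggettSchonmannStacey1997 domination, GandolfiKeaneRusso1988 uniqueness without finite energy,
KohlerschindlerTassion2023 RSW for
symmetric positively associated planar measures), free sprinkling and free coarse-graining inside
the class, and label-level
independence at distance R (exact Borel–Cantelli across scales, OSSS/decision trees as in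
DuminilCopinRaoufiTassion2019). The route
localises the d = 3 difficulty, class-wide, in ONE statement — percolation forces local uniqueness
(crux 2; DuminilcopinKozmaTassion2020
§1.1 "many large clusters avoiding each other") — whose supercritical case is
Grimmett–Marstrand/Antal–Pisztora for the class
(crux 3) and whose complement, a same-t renormalisation from uniqueness events, is provable support;
the planar class theorem (crux 4)
is the consistency check that the sea is not trivially explosive. No existing route or negative of
this summit varies the MODEL; all
nine open routes of the sub-problem are Bernoulli-only.

RANKED CRUXES. #0 ClassNoJump (target) — for every admissible rule F on ℤ³ (measurable, monotone,
range R, Aut(ℤ³)-equivariant, F ∅ = ∅, F E = E, E-supported) and every t ∈ [0,1]: (∀ s < t, θ_F(s) =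
0) → θ_F(t) = 0, where θ_F(t) = (map F (bondPercolation (zdGraph 3) t)).real (percolatesAt 0). Card
item S. (why it might fail: an explosive admissible rule may exist in d = 3 (all lattice hybrid
transitions in print use infinite-range culling: k-core, spiral model arXiv:0709.0378,
interdependent cascades — none finite-range); at F = id it is the conjunct itself.)
[AizenmanNewman1986, Grimmett2006, RiordanWarnke2011, HeydenreichVanDerHofstad2017, arXiv:0709.0378]
#2 PercolationForcesLocalUniqueness (crux) — for every admissible F on ℤ³ and every t with θ_F(t) >
0, μ_t^F(V_n) → 1, where V_n = {some u ∈ Λ_n is n-far-connected (joined inside Λ_n(u) to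
sup-distance n)} ∩ {all n-far-connected u, u′ ∈ Λ_2n are joined inside Λ_6n}: wherever a member of
the class percolates, large clusters do not avoid each other at linear scale. The live case is a
percolating threshold t = t_c(F); t > t_c(F) is crux 3. Card items N2/N3 recast as DKT's missing ⇒
direction. [difficulty: open-problem] (why it might fail: at a percolating t_c nothing known
excludes dense large finite clusters coexisting with the infinite one (DKT2020 §1.1: "many large
clusters avoiding each other"); vdBvE2022 Prop 2: at p_c two distinct clusters cross linear annuli
w.p. ≥ δ on a scale sequence.) [DuminilcopinKozmaTassion2020, VandenbergVanengelenburg2022,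
GrimmettMarstrand1990, AntalPisztora1996, Cerf2015]
#3 ClassSupercritLocalUniqueness (crux) — the strictly supercritical case of crux 2: for admissible
F on ℤ³ and t with θ_F(s) > 0 for some s < t, μ_t^F(V_n) → 1 — Grimmett–Marstrand slab thresholds
plus Pisztora/Antal–Pisztora local uniqueness for every monotone finite-range factor (the
supercritical phase of the class is well behaved). Known for F = id (GM90 + AP96). [deps:
PercolationForcesLocalUniqueness] [difficulty: XL] (why it might fail: GM needs seed
placement/steering and Pisztora's coarse graining uses BK-type disjoint-occurrence bounds and
p_c(slab) ↓ p_c; the output field has neither finite energy nor a BK inequality (only the labels do,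
with range-R overlaps), so slab thresholds may not converge for some rules.) [GrimmettMarstrand1990,
AntalPisztora1996, Grimmett1999, arXiv:2311.00555, DuminilCopinRaoufiTassion2019]
#4 ClassNoJumpPlanar (support since the 2026-08-15 retriage; planar consistency check) — the planar
class theorem: for every admissible F on ℤ² and every t, (∀ s < t, θ_F(s) = 0) → θ_F(t) = 0. Scheme:
GKR88 uniqueness for the primal and the dual output fields (FKG + lattice symmetry + ergodicity, no
finite energy), Zhang's argument (no simultaneous percolation), KST RSW for symmetric positively
associated measures applied to the dual (dual box crossings bounded below along a subsequence ⇒ dual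
circuits at R-separated scales, independent ⇒ no primal percolation), planar duality ⇒ primal long
crossings → 1 at t, polynomial continuity in s of local probabilities, 2D block gluing of rectangle
crossings + k-dependent Peierls ⇒ θ_F(s) > 0 for some s < t: contradiction. Carried from
finitely-dependent-mixed-order r3. [difficulty: L] (why it might fail: GKR88 needs axis-reflection
invariance and separate ergodicity, KST Thm 1 needs π/2-rotation invariance (their Rmk 5: ω_diag) —
supplied by Aut(ℤ²)-equivariance — but exact planar duality of the OUTPUT field and the circuit
Borel–Cantelli must be redone with independence only beyond range R.) [GandolfiKeaneRusso1988,
KohlerschindlerTassion2023, arXiv:2011.04618, Harris1960, Kesten1980, Grimmett1999,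
BollobasRiordan2006, LiggettSchonmannStacey1997]
#9 LocalUniquenessCriterion (support) — same-t static renormalisation from uniqueness events
(DKT2020 Example 1, "⇐ by coarse graining"): there is ε > 0 such that for all n ≥ 1, every
admissible F of range R ≤ n and every t, μ_t^F(V_n) ≥ 1 − ε ⇒ θ_F(t) > 0. Proof sketch: blocks
Λ_n(nx), x ∈ ℤ³; V_n(nx) ∧ V_n(nx′) for adjacent x, x′ glue deterministically (a far-connected point
of Λ_n(nx′) lies in Λ_2n(nx)); the block field is 14-dependent uniformly in n ≥ R (labels in
Λ_7n(nx)); k-dependent Peierls or LSS domination gives an infinite good path, hence an infinite open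
cluster, moved to the origin by translation invariance of μ_t^F. [difficulty: M] [AntalPisztora1996,
LiggettSchonmannStacey1997, Grimmett1999, DuminilcopinKozmaTassion2020]
#9 ClassUniqueness (support) — for admissible F on ℤ³ and 0 < t < 1, μ_t^F-a.s. there is at most one
infinite open cluster. Burton–Keane with encounter REGIONS at the label level: forcing all labels in
Λ_{n+R} below t opens every output edge of Λ_n (F E = E + locality) at cost t^{O(n³)}, which
replaces insertion tolerance of the output field (that can fail: F_e = ω_e ∧ ω_{e+u} is admissible
and not finite-energy); amenability of ℤ³ finishes. F = id is
BurtonKeane1989_atMostOneInfiniteCluster_holds (in tree). [difficulty: M] [BurtonKeane1989,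
GandolfiKeaneNewman1992,
Literature.Barriers.CriticalPhenomena.BurtonKeane1989_atMostOneInfiniteCluster_holds]
#10 NoJumpOfLocalUniqueness (support; the glue cruxes → target, filed 2026-08-16 on the operator's
route-choice hold `target-unreachable`) — PercolationForcesLocalUniqueness →
LocalUniquenessCriterion → ClassNoJump. Closed sorry-free (axioms propext, Classical.choice,
Quot.sound) in the planner's CandidateProof.lean, attached as evidence on
stmt-CriticalPhenomena-14482; a prover lands it under Theorems/. Proof: θ_F(0) = 0 because F ∅ = ∅
(setBernoulli_zero, Measure.map_dirac', theta_bot); for t > 0 take the criterion's ε, crux 2's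
μ_t^F(V_n) → 1 at a percolating t, n ≥ max(R, 1) with μ_t^F(V_n) > 1 − ε/2, and the WEAK-CONTINUITY
LEMMA (for measurable F local of range R and A determined by finitely many pairs, s ↦ μ_s^F(A) is
continuous on [0,1]: μ_s-a.s. ω ⊆ E(ℤ^d), so F⁻¹A agrees a.s. with an event determined by the
finitely many pairs of a box around the determining set, then
continuous_bondPercolation_real_of_determinedBy) applied to V_n, which is determined by the pairs of
Λ_6n (DCT16.determinedBy_openConnIn): some s < t has μ_s^F(V_n) ≥ 1 − ε, the criterion gives θ_F(s)
> 0, contradicting θ_F(s) = 0. Rank 10 only so that the gate renders it after its rank-9 antecedent.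
[difficulty: provable-now] [Grimmett1999, DuminilcopinKozmaTassion2020]

TWO-LAYER PLAN. ClassNoJump ⇐ PercolationForcesLocalUniqueness → LocalUniquenessCriterion →
ClassNoJump — FILED (2026-08-16) as the support item
NoJumpOfLocalUniqueness with a closed proof attached (glue: if θ_F(t) > 0 pick n ≥ R with μ_t^F(V_n)
> 1 − ε/2; V_n pulls back, a.s., to a LOCAL label
event, so s ↦ μ_s^F(V_n) is continuous and exceeds 1 − ε at some s < t; the criterion gives θ_F(s) >
0; t = 0 is settled by F ∅ = ∅). PercolationForcesLocalUniqueness ⇐ ClassSupercritLocalUniqueness →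
CriticalLocalUniqueness (the case ∀ s < t, θ_F(s) = 0 < θ_F(t)) → PercolationForcesLocalUniqueness.
ClassNoJumpPlanar ⇐
PlanarNoCoexistence (GKR + Zhang) → PlanarCrossingsToOne (KST on the dual + R-independent
Borel–Cantelli) → ClassNoJumpPlanar (glue =
the planar LocalUniquenessCriterion with rectangle crossings). k ≤ 3 each, depth 1; the two splits
(of PercolationForcesLocalUniqueness and of ClassNoJumpPlanar) are not filed yet — only the glue to
the target is.

KILL CRITERIA. ClassNoJump refuted by an explicit admissible explosive rule on ℤ³ ⇒ close
`refuted:ClassNoJump` and hand the rule to the barrier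
catalogue (ExplosiveLocalRule: any proof for Bernoulli must then use exact product structure —
BK/Reimer/Russo — beyond FKG + finite
range + finite energy of labels); the card counts this as its negative-side success.
ClassNoJumpPlanar refuted ⇒ the class is wrong
already where Bernoulli continuity is a theorem ⇒ close (pivot only if the witness violates a
hypothesis we can add honestly, e.g.
output finite energy, via --restate of all items). PercolationForcesLocalUniqueness refuted at some
t > t_c(F) (crux 3 false: a
supercritical member with non-unique large clusters) ⇒ restate cruxes 2–3 over the finite-energy
subclass or close; refuted only at a
percolating t_c ⇒ that rule also refutes ClassNoJump (given the support items) — same close.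
ClassUniqueness refuted ⇒ shrink the class
(add label-insertion reachability) by restating every item. Mooted if PercolationContinuityZ3 is
proved by any other route.

NOT DECOMPOSED YET. Subcritical sharpness for the class (OSSS on label decision trees,
DuminilCopinRaoufiTassion2019-style) — layer-2 support only if a split
needs it. The weak-continuity lemma (local output events pull back a.s. to local label events;
continuity in t) is NOT an item: it is a helper
theorem inside the glue's proof file (NoJumpOfLocalUniqueness evidence) and rides with `--supports`;
ClassNoJumpPlanar's prover can reuse it at d = 2. The critical case of
crux 2 is deliberately one node: its children (a class-level two-arm / dense-foam exclusion, or an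
RG statement using closure under
block maps: "an announced jump for F is an announced jump for every B_L ∘ F at scale n/L") wait for
crux 3 or 4 to close. The
renormalisation-closed hull 𝔉^(m) (m label bits per edge, into which block images of 𝔉₃ fall) is not
filed: every argument above is
insensitive to m, and the all-m strengthening is filed only if a scale induction needs it.
Slab/half-space variants, site versions and
d ≥ 4 are out of scope. The negative side (explosive-rule hunt, numerics) is evidence on
ClassNoJump, not an item.

CHEAPEST FALSIFIER. A finite-range, monotone, lattice-symmetric local rule on ℤ² or ℤ³ whose
connectivity percolation jumps — by lookup or by a kit Monte
Carlo sweep over the obvious candidates (one-step bootstrap-AND rules "e open iff U_e < t and ≥ k of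
its 10 adjacent edges have U < t",
plaquette-completion rules, fully-open-cube rules; Binder-cumulant / cluster-size-gap diagnostics at
L = 32…128). Lookup result this
session: none found; RiordanWarnke2011 proves the mean-field version of "local ⇒ continuous", and
every lattice hybrid transition located
(k-core/bootstrap, spiral model arXiv:0709.0378 Thm 'disc' conditional on its Conj. 3.2,
interdependent-lattice cascades, weak multiplex
percolation) iterates a culling map to its fixed point, i.e. has infinite range; their k-step
truncations are in 𝔉 and ClassNoJump
predicts they are continuous — the sharpest cheap numerical test. Also run: F = id instantiation +
assembly proof (done, elaborates and
closes).

NUMBERS. θ(p_c) = 0 known for d = 2 (Harris1960, Kesten1980) and d ≥ 11 (FitznerVanDerHofstad2017);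
open 3 ≤ d ≤ 10. p_c(ℤ³, bond) ≈ 0.2488
(numerics). KST Thm 1: one homeomorphism ψ_ρ per aspect ratio, uniform over all symmetric positively
associated planar measures
(arXiv:2011.04618 p. 3). V_n uses the fixed ratios Λ_n ⊂ Λ_2n ⊂ Λ_6n and block dependence range 14
(labels in Λ_7n when R ≤ n).
Items at open: 7 (1 target, 3 cruxes, 2 support, 1 assembly); after the retriage (2026-08-15) and
the route-choice glue (2026-08-16): 8 items
(1 target, 2 cruxes, 4 support incl. the glue NoJumpOfLocalUniqueness, 1 assembly).

DEFINITION REQUESTS. None needed for elaboration (all hypotheses are inlined over Percolation.lean: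
BondConfig, bondPercolation, percolatesAt, openConnIn,
numInfiniteClusters, zdGraph, Sym2.map, ≃g). Convenience request filed after open: notion
`MonotoneBlockRule` (structure bundling the
seven admissibility hypotheses of a rule F of range R on zdGraph d) with `blockFactorLaw F t :=
(bondPercolation (zdGraph d) t).map F`
and the lemma `MonotoneBlockRule.id`, topic Literature/Probability/Percolation, so that later
restatements and the 𝔉^(m) hull are short.

Novelty: Searches (2026-08-15): `lit search --hybrid "finitely dependent percolation discontinuous phase
transition finite range monotone"` (15
book hits: Grimmett1999 §12 long range, Grimmett2006 first-order RC, HeydenreichVanDerHofstad2017 p.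
229, Baxter et al. Weak Multiplex
Percolation 2021 — culling models); `lit search --source crossref "crossing probabilities planar
percolation Köhler-Schindler Tassion"`
(10: doi:10.1215/00127094-2022-0015, Tassion Voronoi 2016, Muirhead–Rivera–Vanneuville no-FKG 2023);
`lit read arxiv:2011.04618` (Thm 1
hypotheses p. 3, dual p. 5, Rmk 5); `lit read arxiv:1902.03207` p. 3 (scheme (⋆), Examples 1–4);
`lit read` of the review arXiv:1611.03588
p. 7 ("a global evolution rule is necessary", citing RiordanWarnke2011); `lit frontier
CriticalPhenomena --since 2020` (30 rows; nearest:
arXiv:2602.12261 half-plane non-coexistence without FKG, arXiv:2601.09958 general planar site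
percolation); `lit bridges CriticalPhenomena
--cross any` (nothing on dependent-model continuity); zbMATH "k-dependent percolation first-order
transition" (0); `lit galaxy search
"dependent percolation discontinuous transition" --star all` (daemon queue saturated > 90 s, not
charged; arXiv/S2/OpenAlex legs HTTP
429 this session — refuter please re-run the galaxy sweep); ledger: nine Bernoulli-only routes of
the sub, negatives index (1 SAW item),
the two sibling cards (finitely-dependent-mixed-order retired as duplicate of this card;
spiral-ca-hybrid-witness retired, outside class)  [refs: 10.1215/00127094-2022-0015, 10.1126/science.1206241:, 2011.04618, 1902.03207, 1611.03588, 2602.12261, 2601.09958, doi:10.1215/00127094-2022-0015, arxiv:2011.04618, arxiv:1902.03207, doi:10.1126/science.1206241, Grimmett1999, Grimmett2006, HeydenreichVanDerHofstad2017, RiordanWarnke2011, KohlerschindlerTassion2023, GandolfiKeaneRusso1988, DuminilcopinKozmaTassion2020, LiggettSchonmannStacey1997, Ai]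

Barriers (technique_class: rising-sea block-factor-of-iid class-closure): - technique_class: rising-sea block-factor-of-iid class-closure
- Literature.Barriers.CriticalPhenomena.LongRangeDiscontinuity: evaded by hypothesis — every rule
has finite range R; the 1/r² family is the calibration showing the range hypothesis is load-bearing
(it satisfies everything else).
- Literature.Barriers.CriticalPhenomena.RandomClusterFirstOrder: evaded by hypothesis — φ¹_{p,q}, q
> Q, is not a finite-range factor of Bernoulli labels (its local edge density jumps at p_c(q), while
t ↦ μ_t^F(A) is a polynomial for local A); shows the factor/weak-continuity structure is
load-bearing.
- Literature.Barriers.CriticalPhenomena.TreesPercolatingAtCriticality: evaded — only ℤ^d with full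
Aut(ℤ^d)-equivariance; amenability is USED (Burton–Keane encounter regions in ClassUniqueness), so
nothing here is graph-general.
- Literature.Barriers.CriticalPhenomena.AmenableInvariantPercolation: evaded — no degree/density
threshold for general invariant percolations is invoked; LSS domination enters only for k-dependent
BLOCK fields of density 1 − ε (its recorded evasion), inside LocalUniquenessCriterion.
- Literature.Barriers.CriticalPhenomena.SprinklingRenormalisation: it does not evade it at the
critical node; crux 2 at a percolating t_c is Grimmett–Marstrand with η = 0 in uniqueness form. The
bet is that the class supplies what a single model lacks: sprinkling and coarse-graining are
endomorphisms of the family, independence is exact beyond range R, and the η = 0 step is isolated as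

History (route lifecycle, newest last):
- 2026-08-16T03:28:14Z · rev 4: dropped NoJumpOfLocalUniqueness — re-rank only: the gate renders support items by (rank, id-string), so stmt-14348 (rank 9) landed BEFORE LocalUniquenessCriterion (stmt-4492) and was commented o (planner-rchoice-CriticalPhenomena-PercMonotone-e1186655-0)
- 2026-08-16T03:58:06Z · AUTO-CRUX (backfill): ClassNoJump — hypotheses of the deciding theorem that nothing in the route derives are cruxes (operator:999:1085951)
- 2026-08-22T08:16:40Z · DORMANT — reconciler: no traction for 5.2 d (last activity statement-grounded at 2026-08-17T02:53:03Z); parked, not closed — `ledger route dormant route-CriticalPhenomena (operator:999:464080)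
- 2026-08-23T15:05:43Z · REACTIVATED — reconciler: reactivated — activity statement-closed at 2026-08-23T13:14:12Z after parking at 2026-08-22T08:16:40Z (operator:999:2397327)
- 2026-09-01T19:10:33Z · DORMANT — reconciler: no traction for 5 d (last activity statement-checked at 2026-08-27T18:30:42Z); parked, not closed — `ledger route dormant route-CriticalPhenomena-Pe (operator:999:4132563)

sub-problem: PercolationContinuityZ3 · status: dormant · opened planner-plancard-CriticalPhenomena-Percolatio-9ef64bad-0 2026-08-15T11:34:21Z · rev 9 · ledger route-CriticalPhenomena-PercMonotoneFactors
GENERATED by the gate from the ledger (D-0016/17). Provers cite these decls: `theorem foo : Summit.CriticalPhenomena.PercolationContinuityZ3.Theses.PercMonotoneFactors.<Decl> := …` in Summits/CriticalPhenomena/PercolationContinuityZ3/Theorems/<Name>.lean.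
-/

namespace Summit.CriticalPhenomena.PercolationContinuityZ3.Theses.PercMonotoneFactors

open scoped BigOperators Topology Manifold Classical MeasureTheory ProbabilityTheory Matrix InnerProductSpace ComplexConjugate ContinuousMap
open Filter Set Function TopologicalSpace MeasureTheory

attribute [summit_statement] _root_.PercolationContinuityZ3

/-- item stmt-CriticalPhenomena-4488 · crux (kind.auto-crux: conjecture-grade) · rank 0 · open · by planner
why it might fail: an explosive admissible rule may exist in d = 3 (every lattice discontinuous/hybrid transition in print is infinite-range: k-core, spiral model arXiv:0709.0378, interdependent cascades; Achlioptas rules arXiv:2407.10492 are non-local and continuous); at F = id it is the conjunct itself.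
sources: AizenmanNewman1986, Grimmett2006, RiordanWarnke2011, HeydenreichVanDerHofstad2017, arXiv:0709.0378, arXiv:2407.10492
[target] for every admissible rule F on ℤ³ (measurable, monotone, range R, Aut(ℤ³)-equivariant, F ∅
= ∅, F E = E, E-supported) and every t ∈ [0,1]: (∀ s < t, θ_F(s) = 0) → θ_F(t) = 0, where θ_F(t) =
(map F (bondPercolation (zdGraph 3) t)).real (percolatesAt 0). Card item S. -/
@[route_item "route-CriticalPhenomena-PercMonotoneFactors"]
def ClassNoJump : Prop :=
  ∀ (R : ℕ) (F : Literature.Probability.Percolation.BondConfig (Literature.Probability.LatticeModels.Site 3) → Literature.Probability.Percolation.BondConfig (Literature.Probability.LatticeModels.Site 3)), Measurable F → Monotone F → F ∅ = ∅ → F (Literature.Probability.LatticeModels.zdGraph 3).edgeSet = (Literature.Probability.LatticeModels.zdGraph 3).edgeSet → (∀ ω : Literature.Probability.Percolation.BondConfig (Literature.Probability.LatticeModels.Site 3), ω ⊆ (Literature.Probability.LatticeModels.zdGraph 3).edgeSet → F ω ⊆ (Literature.Probability.LatticeModels.zdGraph 3).edgeSet) → (∀ (φ : Literature.Probability.LatticeModels.zdGraph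 3 ≃g Literature.Probability.LatticeModels.zdGraph 3) (ω : Literature.Probability.Percolation.BondConfig (Literature.Probability.LatticeModels.Site 3)), F (Sym2.map φ '' ω) = Sym2.map φ '' (F ω)) → (∀ (ω ω' : Literature.Probability.Percolation.BondConfig (Literature.Probability.LatticeModels.Site 3)) (e : Sym2 (Literature.Probability.LatticeModels.Site 3)), (∀ e' : Sym2 (Literature.Probability.LatticeModels.Site 3), (∃ x ∈ e, ∃ y ∈ e', ∀ i, |x i - y i| ≤ (R : ℤ)) → (e' ∈ ω ↔ e' ∈ ω')) → (e ∈ F ω ↔ e ∈ F ω')) → ∀ t : unitInterval, (∀ s : unitInterval, s < t → ((Literature.Probability.Percolation.bondPercolation (Literature.Probability.LatticeModels.zdGraph 3) s).map F).real (Literature.Probability.Percolation.percolatesAt 0) = 0) → ((Literature.Probability.Percolation.bondPercolation (Literature.Probability.LatticeModels.zdGraph 3) t).map F).real (Literature.Probability.Percolation.percolatesAt 0) = 0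

/-- item stmt-CriticalPhenomena-4489 · aside · rank 2 · open · by planner
why it might fail: at a percolating t_c nothing known excludes dense large finite clusters avoiding the infinite one (arXiv:1902.03207 §1.1 Ex. 1–2: the ⇒ direction is the open step); at p_c two distinct clusters cross annuli (n_i, Mn_i) w.p. ≥ δ on a scale sequence (vdBvE2022 Prop. 1.2); F = id at p_c: the conjunct.
sources: DuminilcopinKozmaTassion2020, arXiv:1902.03207, VandenbergVanengelenburg2022, doi:10.1214/21-aihp1153, GrimmettMarstrand1990, AntalPisztora1996
[crux] for every admissible F on ℤ³ and every t with θ_F(t) > 0, μ_t^F(V_n) → 1, where V_n = {some u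
∈ Λ_n is n-far-connected (joined inside Λ_n(u) to sup-distance n)} ∩ {all n-far-connected u, u′ ∈
Λ_2n are joined inside Λ_6n}: wherever a member of the class percolates, large clusters do not avoid
each other at linear scale. The live case is a percolating threshold t = t_c(F); t > t_c(F) is crux
3. Card items N2/N3 recast as DKT's missing ⇒ direction. [difficulty: open-problem] -/
@[route_item "route-CriticalPhenomena-PercMonotoneFactors"]
def PercolationForcesLocalUniqueness : Prop :=
  ∀ (R : ℕ) (F : Literature.Probability.Percolation.BondConfig (Literature.Probability.LatticeModels.Site 3) → Literature.Probability.Percolation.BondConfig (Literature.Probability.LatticeModels.Site 3)), Measurable F → Monotone F → F ∅ = ∅ → F (Literature.Probability.LatticeModels.zdGraph 3).edgeSet = (Literature.Probability.LatticeModels.zdGraph 3).edgeSet → (∀ ω : Literature.Probability.Percolation.BondConfig (Literature.Probability.LatticeModels.Site 3), ω ⊆ (Literature.Probability.LatticeModels.zdGraph 3).edgeSet → F ω ⊆ (Literature.Probability.LatticeModels.zdGraph 3).edgeSet) → (∀ (φ : Literature.Probability.LatticeModels.zdGraph 3 ≃g Literature.Probability.LatticeModels.zdGraph 3) (ω : Literature.Probability.Percolation.BondConfig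 (Literature.Probability.LatticeModels.Site 3)), F (Sym2.map φ '' ω) = Sym2.map φ '' (F ω)) → (∀ (ω ω' : Literature.Probability.Percolation.BondConfig (Literature.Probability.LatticeModels.Site 3)) (e : Sym2 (Literature.Probability.LatticeModels.Site 3)), (∀ e' : Sym2 (Literature.Probability.LatticeModels.Site 3), (∃ x ∈ e, ∃ y ∈ e', ∀ i, |x i - y i| ≤ (R : ℤ)) → (e' ∈ ω ↔ e' ∈ ω')) → (e ∈ F ω ↔ e ∈ F ω')) → ∀ t : unitInterval, 0 < ((Literature.Probability.Percolation.bondPercolation (Literature.Probability.LatticeModels.zdGraph 3) t).map F).real (Literature.Probability.Percolation.percolatesAt 0) → Filter.Tendsto (fun n : ℕ => ((Literature.Probability.Percolation.bondPercolation (Literature.Probability.LatticeModels.zdGraph 3) t).map F).real {ω : Literature.Probability.Percolation.BondConfig (Literature.Probability.LatticeModels.Site 3) | (∃ u : Literature.Probability.LatticeModels.Site 3, (∀ i, |u i| ≤ (n : ℤ)) ∧ (∃ y : Literature.Probability.LatticeModels.Site 3, (∃ i, |y i - u i| = (n : ℤ)) ∧ ω ∈ Literature.Probability.Percolation.openConnIn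 {z : Literature.Probability.LatticeModels.Site 3 | ∀ i, |z i - u i| ≤ (n : ℤ)} u y)) ∧ (∀ u u' : Literature.Probability.LatticeModels.Site 3, (∀ i, |u i| ≤ 2 * (n : ℤ)) → (∀ i, |u' i| ≤ 2 * (n : ℤ)) → (∃ y : Literature.Probability.LatticeModels.Site 3, (∃ i, |y i - u i| = (n : ℤ)) ∧ ω ∈ Literature.Probability.Percolation.openConnIn {z : Literature.Probability.LatticeModels.Site 3 | ∀ i, |z i - u i| ≤ (n : ℤ)} u y) → (∃ y : Literature.Probability.LatticeModels.Site 3, (∃ i, |y i - u' i| = (n : ℤ)) ∧ ω ∈ Literature.Probability.Percolation.openConnIn {z : Literature.Probability.LatticeModels.Site 3 | ∀ i, |z i - u' i| ≤ (n : ℤ)} u' y) → ω ∈ Literature.Probability.Percolation.openConnIn {z : Literature.Probability.LatticeModels.Site 3 | ∀ i, |z i| ≤ 6 * (n : ℤ)} u u')}) Filter.atTop (nhds 1)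

/-- item stmt-CriticalPhenomena-4490 · aside · rank 3 · open · by planner
why it might fail: F = id is Grimmett1999 Thm (7.61)+(7.2), proved by sprinkling past negative information with output finite energy; the factor field has no insertion tolerance or BK (labels only, range-R spillover); dependent supercritical sharpness took a paper each time (arXiv:2311.00555, DGRS 2023, Bodineau2004).
sources: Grimmett1999, GrimmettMarstrand1990, AntalPisztora1996, Pisztora1996, arXiv:2311.00555, DuminilcopinEtAl2023
[crux] the strictly supercritical case of crux 2: for admissible F on ℤ³ and t with θ_F(s) > 0 for
some s < t, μ_t^F(V_n) → 1 — Grimmett–Marstrand slab thresholds plus Pisztora/Antal–Pisztora local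
uniqueness for every monotone finite-range factor (the supercritical phase of the class is well
behaved). Known for F = id (GM90 + AP96). [deps: PercolationForcesLocalUniqueness] [difficulty: XL] -/
@[route_item "route-CriticalPhenomena-PercMonotoneFactors"]
def ClassSupercritLocalUniqueness : Prop :=
  ∀ (R : ℕ) (F : Literature.Probability.Percolation.BondConfig (Literature.Probability.LatticeModels.Site 3) → Literature.Probability.Percolation.BondConfig (Literature.Probability.LatticeModels.Site 3)), Measurable F → Monotone F → F ∅ = ∅ → F (Literature.Probability.LatticeModels.zdGraph 3).edgeSet = (Literature.Probability.LatticeModels.zdGraph 3).edgeSet → (∀ ω : Literature.Probability.Percolation.BondConfig (Literature.Probability.LatticeModels.Site 3), ω ⊆ (Literature.Probability.LatticeModels.zdGraph 3).edgeSet → F ω ⊆ (Literature.Probability.LatticeModels.zdGraph 3).edgeSet) → (∀ (φ : Literature.Probability.LatticeModels.zdGraph 3 ≃g Literature.Probability.LatticeModels.zdGraph 3) (ω : Literature.Probability.Percolation.BondConfig (Literature.Probability.LatticeModels.Site 3)), F (Sym2.map φ '' ω) = Sym2.map φ '' (F ω)) → (∀ (ω ω' : Literature.Probability.Percolation.BondConfig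 (Literature.Probability.LatticeModels.Site 3)) (e : Sym2 (Literature.Probability.LatticeModels.Site 3)), (∀ e' : Sym2 (Literature.Probability.LatticeModels.Site 3), (∃ x ∈ e, ∃ y ∈ e', ∀ i, |x i - y i| ≤ (R : ℤ)) → (e' ∈ ω ↔ e' ∈ ω')) → (e ∈ F ω ↔ e ∈ F ω')) → ∀ t : unitInterval, (∃ s : unitInterval, s < t ∧ 0 < ((Literature.Probability.Percolation.bondPercolation (Literature.Probability.LatticeModels.zdGraph 3) s).map F).real (Literature.Probability.Percolation.percolatesAt 0)) → Filter.Tendsto (fun n : ℕ => ((Literature.Probability.Percolation.bondPercolation (Literature.Probability.LatticeModels.zdGraph 3) t).map F).real {ω : Literature.Probability.Percolation.BondConfig (Literature.Probability.LatticeModels.Site 3) | (∃ u : Literature.Probability.LatticeModels.Site 3, (∀ i, |u i| ≤ (n : ℤ)) ∧ (∃ y : Literature.Probability.LatticeModels.Site 3, (∃ i, |y i - u i| = (n : ℤ)) ∧ ω ∈ Literature.Probability.Percolation.openConnIn {z : Literature.Probability.LatticeModels.Site 3 | ∀ i, |z i - u i| ≤ (n : ℤ)} u y)) ∧ (∀ u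 u' : Literature.Probability.LatticeModels.Site 3, (∀ i, |u i| ≤ 2 * (n : ℤ)) → (∀ i, |u' i| ≤ 2 * (n : ℤ)) → (∃ y : Literature.Probability.LatticeModels.Site 3, (∃ i, |y i - u i| = (n : ℤ)) ∧ ω ∈ Literature.Probability.Percolation.openConnIn {z : Literature.Probability.LatticeModels.Site 3 | ∀ i, |z i - u i| ≤ (n : ℤ)} u y) → (∃ y : Literature.Probability.LatticeModels.Site 3, (∃ i, |y i - u' i| = (n : ℤ)) ∧ ω ∈ Literature.Probability.Percolation.openConnIn {z : Literature.Probability.LatticeModels.Site 3 | ∀ i, |z i - u' i| ≤ (n : ℤ)} u' y) → ω ∈ Literature.Probability.Percolation.openConnIn {z : Literature.Probability.LatticeModels.Site 3 | ∀ i, |z i| ≤ 6 * (n : ℤ)} u u')}) Filter.atTop (nhds 1)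

/-- item stmt-CriticalPhenomena-4491 · support · rank 4 · closed · proved by Summit.CriticalPhenomena.PercolationContinuityZ3.Theorems.ClassNoJumpPlanar_proof @ b4aad75eafd0 (prover) · by planner
why it might fail: GKR88 needs axis-reflection invariance and separate ergodicity, KST Thm 1 needs π/2-rotation invariance (their Rmk 5: ω_diag) — supplied by Aut(ℤ²)-equivariance — but exact planar duality of the OUTPUT field and the circuit Borel–Cantelli must be redone with independence only beyond range R.
sources: GandolfiKeaneRusso1988, KohlerschindlerTassion2023, arXiv:2011.04618, arXiv:1103.0901, arXiv:2405.07345, Harris1960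
[crux] the planar class theorem: for every admissible F on ℤ² and every t, (∀ s < t, θ_F(s) = 0) →
θ_F(t) = 0. Scheme: GKR88 uniqueness for the primal and the dual output fields (FKG + lattice
symmetry + ergodicity, no finite energy), Zhang's argument (no simultaneous percolation), KST RSW
for symmetric positively associated measures applied to the dual (dual box crossings bounded below
along a subsequence ⇒ dual circuits at R-separated scales, independent ⇒ no primal percolation),
planar duality ⇒ primal long crossings → 1 at t, polynomial continuity in s of local probabilities,
2D block gluing of rectangle crossings + k-dependent Peierls ⇒ θ_F(s) > 0 for some s < t:
contradiction. Carried from finitely-dependent-mixed-order r3. [difficulty: L] -/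
@[route_item "route-CriticalPhenomena-PercMonotoneFactors"]
def ClassNoJumpPlanar : Prop :=
  ∀ (R : ℕ) (F : Literature.Probability.Percolation.BondConfig (Literature.Probability.LatticeModels.Site 2) → Literature.Probability.Percolation.BondConfig (Literature.Probability.LatticeModels.Site 2)), Measurable F → Monotone F → F ∅ = ∅ → F (Literature.Probability.LatticeModels.zdGraph 2).edgeSet = (Literature.Probability.LatticeModels.zdGraph 2).edgeSet → (∀ ω : Literature.Probability.Percolation.BondConfig (Literature.Probability.LatticeModels.Site 2), ω ⊆ (Literature.Probability.LatticeModels.zdGraph 2).edgeSet → F ω ⊆ (Literature.Probability.LatticeModels.zdGraph 2).edgeSet) → (∀ (φ : Literature.Probability.LatticeModels.zdGraph 2 ≃g Literature.Probability.LatticeModels.zdGraph 2) (ω : Literature.Probability.Percolation.BondConfig (Literature.Probability.LatticeModels.Site 2)), F (Sym2.map φ '' ω) = Sym2.map φ '' (F ω)) → (∀ (ω ω' : Literature.Probability.Percolation.BondConfig (Literature.Probability.LatticeModels.Site 2)) (e : Sym2 (Literature.Probability.LatticeModels.Site 2)), (∀ e' : Sym2 (Literature.Probability.LatticeModels.Site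 2), (∃ x ∈ e, ∃ y ∈ e', ∀ i, |x i - y i| ≤ (R : ℤ)) → (e' ∈ ω ↔ e' ∈ ω')) → (e ∈ F ω ↔ e ∈ F ω')) → ∀ t : unitInterval, (∀ s : unitInterval, s < t → ((Literature.Probability.Percolation.bondPercolation (Literature.Probability.LatticeModels.zdGraph 2) s).map F).real (Literature.Probability.Percolation.percolatesAt 0) = 0) → ((Literature.Probability.Percolation.bondPercolation (Literature.Probability.LatticeModels.zdGraph 2) t).map F).real (Literature.Probability.Percolation.percolatesAt 0) = 0

-- `ClassNoJumpPlanar` holds: proved by `Summit.CriticalPhenomena.PercolationContinuityZ3.Theorems.ClassNoJumpPlanar_proof` @ b4aad75eafd0 (its module imports this route file, so no `_holds` link can be stated here).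

/-- item stmt-CriticalPhenomena-18047 · aside · rank 5 · open · by planner
why it might fail: At a percolating threshold nothing excludes two large clusters passing within √n of each other in Λ_2n yet avoiding each other inside Λ_6n (DKT2020 §1.1; vdBvE2022: at p_c distinct clusters cross annuli w.p. ≥ δ); sprinkling-free gluing is the open Grimmett–Marstrand η = 0 step even for F = id.
sources: DuminilcopinKozmaTassion2020, arXiv:1902.03207, VandenbergVanengelenburg2022, AntalPisztora1996, GrimmettMarstrand1990, Cerf2015
[crux] MESOSCOPIC GLUING (close large clusters glue): for every admissible rule F on ℤ³ and every t
with θ_F(t) > 0, μ_t^F(G_n) → 1, where G_n = {any two n-far-connected points u, u′ ∈ Λ_2n at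
sup-distance ≤ 3m, m = ⌊√n⌋+1, are joined inside Λ_6n} (u is n-far-connected if it is joined inside
Λ_n(u) to sup-distance n). Child 1 of the mesoscopic split of ClassNoJump: with MesoscopicDensity it
gives PercolationForcesLocalUniqueness by deterministic chaining (ClassNoJump_of_mesoscopic,
kernel-checked, evidence Split.lean). Weaker than the uniqueness half of V_n (only CLOSE pairs). At
F = id: known for p > p_c (Antal–Pisztora local uniqueness), OPEN at a percolating p_c, and it
yields θ(p_c) = 0 only together with MesoscopicDensity (interlocking pieces: gluing needs density to
chain, density needs gluing to connect). (why it might fail: At a percolating threshold nothing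
excludes two large clusters passing within √n of each other in Λ_2n yet avoiding each other inside
Λ_6n (DKT2020 §1.1 'many large clusters avoiding each other'; vdBvE2022: at p_c distinct clusters
cross annuli w.p. ≥ δ); sprinkling-free gluing is the open Grimmett–Marstrand η = 0 step even for F
= id.) [DuminilcopinKozm -/
@[route_item "route-CriticalPhenomena-PercMonotoneFactors"]
def MesoscopicGluing : Prop :=
  ∀ (R : ℕ) (F : Literature.Probability.Percolation.BondConfig (Literature.Probability.LatticeModels.Site 3) → Literature.Probability.Percolation.BondConfig (Literature.Probability.LatticeModels.Site 3)), Measurable F → Monotone F → F ∅ = ∅ → F (Literature.Probability.LatticeModels.zdGraph 3).edgeSet = (Literature.Probability.LatticeModels.zdGraph 3).edgeSet → (∀ ω : Literature.Probability.Percolation.BondConfig (Literature.Probability.LatticeModels.Site 3), ω ⊆ (Literature.Probability.LatticeModels.zdGraph 3).edgeSet → F ω ⊆ (Literature.Probability.LatticeModels.zdGraph 3).edgeSet) → (∀ (φ : Literature.Probability.LatticeModels.zdGraph 3 ≃g Literature.Probability.LatticeModels.zdGraph 3) (ω : Literature.Probability.Percolation.BondConfig (Literature.Probability.LatticeModels.Site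 3)), F (Sym2.map φ '' ω) = Sym2.map φ '' (F ω)) → (∀ (ω ω' : Literature.Probability.Percolation.BondConfig (Literature.Probability.LatticeModels.Site 3)) (e : Sym2 (Literature.Probability.LatticeModels.Site 3)), (∀ e' : Sym2 (Literature.Probability.LatticeModels.Site 3), (∃ x ∈ e, ∃ y ∈ e', ∀ i, |x i - y i| ≤ (R : ℤ)) → (e' ∈ ω ↔ e' ∈ ω')) → (e ∈ F ω ↔ e ∈ F ω')) → ∀ t : unitInterval, 0 < ((Literature.Probability.Percolation.bondPercolation (Literature.Probability.LatticeModels.zdGraph 3) t).map F).real (Literature.Probability.Percolation.percolatesAt 0) → Filter.Tendsto (fun n : ℕ => ((Literature.Probability.Percolation.bondPercolation (Literature.Probability.LatticeModels.zdGraph 3) t).map F).real {ω : Literature.Probability.Percolation.BondConfig (Literature.Probability.LatticeModels.Site 3) | ∀ u u' : Literature.Probability.LatticeModels.Site 3, (∀ i, |u i| ≤ 2 * (n : ℤ)) → (∀ i, |u' i| ≤ 2 * (n : ℤ)) → (∀ i, |u i - u' i| ≤ 3 * ((Nat.sqrt n + 1 : ℕ) : ℤ)) → (∃ y : Literature.Probability.LatticeModels.Site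 3, (∃ i, |y i - u i| = (n : ℤ)) ∧ ω ∈ Literature.Probability.Percolation.openConnIn {z : Literature.Probability.LatticeModels.Site 3 | ∀ i, |z i - u i| ≤ (n : ℤ)} u y) → (∃ y : Literature.Probability.LatticeModels.Site 3, (∃ i, |y i - u' i| = (n : ℤ)) ∧ ω ∈ Literature.Probability.Percolation.openConnIn {z : Literature.Probability.LatticeModels.Site 3 | ∀ i, |z i - u' i| ≤ (n : ℤ)} u' y) → ω ∈ Literature.Probability.Percolation.openConnIn {z : Literature.Probability.LatticeModels.Site 3 | ∀ i, |z i| ≤ 6 * (n : ℤ)} u u'}) Filter.atTop (nhds 1)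

/-- item stmt-CriticalPhenomena-18049 · aside · rank 6 · open · by planner
why it might fail: At a percolating threshold the infinite cluster may leave √n-holes in Λ_2n with non-vanishing probability: the union bound needs P(Λ_k ∩ C_∞ = ∅) = o(k⁻³), a rate for the one-arm of finite clusters, unknown at p_c even for F = id; a slowly mixing supercritical member could also fail at scale √n.
sources: Grimmett1999, GrimmettMarstrand1990, DuminilcopinKozmaTassion2020, arXiv:1902.03207, Cerf2015, AntalPisztora1996
[crux] MESOSCOPIC DENSITY (large clusters leave no mesoscopic holes): for every admissible rule F on
ℤ³ and every t with θ_F(t) > 0, μ_t^F(D_n) → 1, where D_n = {every v ∈ Λ_2n lies within sup-distance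
m = ⌊√n⌋+1 of an n-far-connected point u ∈ Λ_2n}. Child 2 of the mesoscopic split of ClassNoJump
(chaining partner of MesoscopicGluing; D_n at v = 0 also supplies the existence half of V_n since m
≤ n). A statement about the GEOMETRY of the large clusters (relative density at scale √n), not about
their connections. At F = id: known for p > p_c (holes of the infinite cluster have surface-order
cost, Grimmett–Marstrand), OPEN at a percolating p_c — the union bound over the (4n/m)³ mesoscopic
boxes needs a RATE o(m⁻³) for P(Λ_m misses the infinite cluster), i.e. a decay rate for the one-arm
of FINITE clusters, unknown at p_c; yields θ(p_c) = 0 only together with MesoscopicGluing. (why it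
might fail: At a percolating threshold the infinite cluster (density θ_F > 0) may leave holes of
size √n in Λ_2n with non-vanishing probability: the proof needs P(Λ_k ∩ C_∞ = ∅) = o(k⁻³), i.e. a
rate for the one-arm of finite clusters P(k ≤ rad C(0) < ∞), unknown at p_c even for F = id; a
slowly-mixing -/
@[route_item "route-CriticalPhenomena-PercMonotoneFactors"]
def MesoscopicDensity : Prop :=
  ∀ (R : ℕ) (F : Literature.Probability.Percolation.BondConfig (Literature.Probability.LatticeModels.Site 3) → Literature.Probability.Percolation.BondConfig (Literature.Probability.LatticeModels.Site 3)), Measurable F → Monotone F → F ∅ = ∅ → F (Literature.Probability.LatticeModels.zdGraph 3).edgeSet = (Literature.Probability.LatticeModels.zdGraph 3).edgeSet → (∀ ω : Literature.Probability.Percolation.BondConfig (Literature.Probability.LatticeModels.Site 3), ω ⊆ (Literature.Probability.LatticeModels.zdGraph 3).edgeSet → F ω ⊆ (Literature.Probability.LatticeModels.zdGraph 3).edgeSet) → (∀ (φ : Literature.Probability.LatticeModels.zdGraph 3 ≃g Literature.Probability.LatticeModels.zdGraph 3) (ω : Literature.Probability.Percolation.BondConfig (Literature.Probability.LatticeModels.Site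 3)), F (Sym2.map φ '' ω) = Sym2.map φ '' (F ω)) → (∀ (ω ω' : Literature.Probability.Percolation.BondConfig (Literature.Probability.LatticeModels.Site 3)) (e : Sym2 (Literature.Probability.LatticeModels.Site 3)), (∀ e' : Sym2 (Literature.Probability.LatticeModels.Site 3), (∃ x ∈ e, ∃ y ∈ e', ∀ i, |x i - y i| ≤ (R : ℤ)) → (e' ∈ ω ↔ e' ∈ ω')) → (e ∈ F ω ↔ e ∈ F ω')) → ∀ t : unitInterval, 0 < ((Literature.Probability.Percolation.bondPercolation (Literature.Probability.LatticeModels.zdGraph 3) t).map F).real (Literature.Probability.Percolation.percolatesAt 0) → Filter.Tendsto (fun n : ℕ => ((Literature.Probability.Percolation.bondPercolation (Literature.Probability.LatticeModels.zdGraph 3) t).map F).real {ω : Literature.Probability.Percolation.BondConfig (Literature.Probability.LatticeModels.Site 3) | ∀ v : Literature.Probability.LatticeModels.Site 3, (∀ i, |v i| ≤ 2 * (n : ℤ)) → ∃ u : Literature.Probability.LatticeModels.Site 3, (∀ i, |u i - v i| ≤ ((Nat.sqrt n + 1 : ℕ) : ℤ)) ∧ (∀ i, |u i| ≤ 2 *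 (n : ℤ)) ∧ (∃ y : Literature.Probability.LatticeModels.Site 3, (∃ i, |y i - u i| = (n : ℤ)) ∧ ω ∈ Literature.Probability.Percolation.openConnIn {z : Literature.Probability.LatticeModels.Site 3 | ∀ i, |z i - u i| ≤ (n : ℤ)} u y)}) Filter.atTop (nhds 1)

/-- item stmt-CriticalPhenomena-4492 · support · rank 9 · closed · proved by Summit.CriticalPhenomena.PercolationContinuityZ3.Theorems.LocalUniquenessCriterion_proof @ b4aad75eafd0 (prover) · by planner
sources: AntalPisztora1996, LiggettSchonmannStacey1997, Grimmett1999, DuminilcopinKozmaTassion2020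
[support] same-t static renormalisation from uniqueness events (DKT2020 Example 1, "⇐ by coarse
graining"): there is ε > 0 such that for all n ≥ 1, every admissible F of range R ≤ n and every t,
μ_t^F(V_n) ≥ 1 − ε ⇒ θ_F(t) > 0. Proof sketch: blocks Λ_n(nx), x ∈ ℤ³; V_n(nx) ∧ V_n(nx′) for
adjacent x, x′ glue deterministically (a far-connected point of Λ_n(nx′) lies in Λ_2n(nx)); the
block field is 14-dependent uniformly in n ≥ R (labels in Λ_7n(nx)); k-dependent Peierls or LSS
domination gives an infinite good path, hence an infinite open cluster, moved to the origin by
translation invariance of μ_t^F. [difficulty: M] -/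
@[route_item "route-CriticalPhenomena-PercMonotoneFactors"]
def LocalUniquenessCriterion : Prop :=
  ∃ ε : ℝ, 0 < ε ∧ ∀ n : ℕ, 1 ≤ n → ∀ (R : ℕ) (F : Literature.Probability.Percolation.BondConfig (Literature.Probability.LatticeModels.Site 3) → Literature.Probability.Percolation.BondConfig (Literature.Probability.LatticeModels.Site 3)), R ≤ n → Measurable F → Monotone F → F ∅ = ∅ → F (Literature.Probability.LatticeModels.zdGraph 3).edgeSet = (Literature.Probability.LatticeModels.zdGraph 3).edgeSet → (∀ ω : Literature.Probability.Percolation.BondConfig (Literature.Probability.LatticeModels.Site 3), ω ⊆ (Literature.Probability.LatticeModels.zdGraph 3).edgeSet → F ω ⊆ (Literature.Probability.LatticeModels.zdGraph 3).edgeSet) → (∀ (φ : Literature.Probability.LatticeModels.zdGraph 3 ≃g Literature.Probability.LatticeModels.zdGraph 3) (ω : Literature.Probability.Percolation.BondConfig (Literature.Probability.LatticeModels.Site 3)), F (Sym2.map φ '' ω) = Sym2.map φ '' (F ω)) → (∀ (ω ω' : Literature.Probability.Percolation.BondConfig (Literature.Probability.LatticeModels.Site 3)) (e : Sym2 (Literature.Probability.LatticeModels.Site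 3)), (∀ e' : Sym2 (Literature.Probability.LatticeModels.Site 3), (∃ x ∈ e, ∃ y ∈ e', ∀ i, |x i - y i| ≤ (R : ℤ)) → (e' ∈ ω ↔ e' ∈ ω')) → (e ∈ F ω ↔ e ∈ F ω')) → ∀ t : unitInterval, 1 - ε ≤ ((Literature.Probability.Percolation.bondPercolation (Literature.Probability.LatticeModels.zdGraph 3) t).map F).real {ω : Literature.Probability.Percolation.BondConfig (Literature.Probability.LatticeModels.Site 3) | (∃ u : Literature.Probability.LatticeModels.Site 3, (∀ i, |u i| ≤ (n : ℤ)) ∧ (∃ y : Literature.Probability.LatticeModels.Site 3, (∃ i, |y i - u i| = (n : ℤ)) ∧ ω ∈ Literature.Probability.Percolation.openConnIn {z : Literature.Probability.LatticeModels.Site 3 | ∀ i, |z i - u i| ≤ (n : ℤ)} u y)) ∧ (∀ u u' : Literature.Probability.LatticeModels.Site 3, (∀ i, |u i| ≤ 2 * (n : ℤ)) → (∀ i, |u' i| ≤ 2 * (n : ℤ)) → (∃ y : Literature.Probability.LatticeModels.Site 3, (∃ i, |y i - u i| = (n : ℤ)) ∧ ω ∈ Literature.Probability.Percolation.openConnIn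 {z : Literature.Probability.LatticeModels.Site 3 | ∀ i, |z i - u i| ≤ (n : ℤ)} u y) → (∃ y : Literature.Probability.LatticeModels.Site 3, (∃ i, |y i - u' i| = (n : ℤ)) ∧ ω ∈ Literature.Probability.Percolation.openConnIn {z : Literature.Probability.LatticeModels.Site 3 | ∀ i, |z i - u' i| ≤ (n : ℤ)} u' y) → ω ∈ Literature.Probability.Percolation.openConnIn {z : Literature.Probability.LatticeModels.Site 3 | ∀ i, |z i| ≤ 6 * (n : ℤ)} u u')} → 0 < ((Literature.Probability.Percolation.bondPercolation (Literature.Probability.LatticeModels.zdGraph 3) t).map F).real (Literature.Probability.Percolation.percolatesAt 0)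

-- `LocalUniquenessCriterion` holds: proved by `Summit.CriticalPhenomena.PercolationContinuityZ3.Theorems.LocalUniquenessCriterion_proof` @ b4aad75eafd0 (its module imports this route file, so no `_holds` link can be stated here).

/-- item stmt-CriticalPhenomena-4493 · support · rank 9 · closed · proved by Summit.CriticalPhenomena.PercolationContinuityZ3.Theorems.classUniqueness_proof @ 9c03de15e406 (prover) · by planner
sources: BurtonKeane1989, GandolfiKeaneNewman1992, Literature.Barriers.CriticalPhenomena.BurtonKeane1989_atMostOneInfiniteCluster_holds
[support] for admissible F on ℤ³ and 0 < t < 1, μ_t^F-a.s. there is at most one infinite open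
cluster. Burton–Keane with encounter REGIONS at the label level: forcing all labels in Λ_{n+R} below
t opens every output edge of Λ_n (F E = E + locality) at cost t^{O(n³)}, which replaces insertion
tolerance of the output field (that can fail: F_e = ω_e ∧ ω_{e+u} is admissible and not
finite-energy); amenability of ℤ³ finishes. F = id is BurtonKeane1989_atMostOneInfiniteCluster_holds
(in tree). [difficulty: M] -/
@[route_item "route-CriticalPhenomena-PercMonotoneFactors"]
def ClassUniqueness : Prop :=
  ∀ (R : ℕ) (F : Literature.Probability.Percolation.BondConfig (Literature.Probability.LatticeModels.Site 3) → Literature.Probability.Percolation.BondConfig (Literature.Probability.LatticeModels.Site 3)), Measurable F → Monotone F → F ∅ = ∅ → F (Literature.Probability.LatticeModels.zdGraph 3).edgeSet = (Literature.Probability.LatticeModels.zdGraph 3).edgeSet → (∀ ω : Literature.Probability.Percolation.BondConfig (Literature.Probability.LatticeModels.Site 3), ω ⊆ (Literature.Probability.LatticeModels.zdGraph 3).edgeSet → F ω ⊆ (Literature.Probability.LatticeModels.zdGraph 3).edgeSet) → (∀ (φ : Literature.Probability.LatticeModels.zdGraph 3 ≃g Literature.Probability.LatticeModels.zdGraph 3)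 (ω : Literature.Probability.Percolation.BondConfig (Literature.Probability.LatticeModels.Site 3)), F (Sym2.map φ '' ω) = Sym2.map φ '' (F ω)) → (∀ (ω ω' : Literature.Probability.Percolation.BondConfig (Literature.Probability.LatticeModels.Site 3)) (e : Sym2 (Literature.Probability.LatticeModels.Site 3)), (∀ e' : Sym2 (Literature.Probability.LatticeModels.Site 3), (∃ x ∈ e, ∃ y ∈ e', ∀ i, |x i - y i| ≤ (R : ℤ)) → (e' ∈ ω ↔ e' ∈ ω')) → (e ∈ F ω ↔ e ∈ F ω')) → ∀ t : unitInterval, 0 < (t : ℝ) → (t : ℝ) < 1 → ∀ᵐ ω ∂((Literature.Probability.Percolation.bondPercolation (Literature.Probability.LatticeModels.zdGraph 3) t).map F), Literature.Probability.Percolation.numInfiniteClusters ω ≤ 1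

-- `ClassUniqueness` holds: proved by `Summit.CriticalPhenomena.PercolationContinuityZ3.Theorems.classUniqueness_proof` @ 9c03de15e406 (its module imports this route file, so no `_holds` link can be stated here).

/-- item stmt-CriticalPhenomena-14482 · support · rank 10 · closed · proved by Summit.CriticalPhenomena.PercolationContinuityZ3.Theorems.NoJumpOfLocalUniqueness_proof (prover) · by planner
sources: DuminilcopinKozmaTassion2020, Grimmett1999
[support] glue of the TWO-LAYER PLAN, cruxes -> target: PercolationForcesLocalUniqueness ->
LocalUniquenessCriterion -> ClassNoJump. PROVABLE NOW — closed sorry-free (axioms propext,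
Classical.choice, Quot.sound) in the planner's SketchProof.lean (2026-08-16, attached as evidence; a
prover can land it verbatim under Theorems/). Proof: fix an admissible F of range R and t with
theta_F(s) = 0 for all s < t and suppose theta_F(t) > 0 (measureReal_nonneg). Case t = 0:
bondPercolation (zdGraph 3) 0 = dirac emptyset (setBernoulli_zero), map F (dirac emptyset) = dirac
(F emptyset) = dirac emptyset (Measure.map_dirac', F emptyset = emptyset), so theta_F(0) = theta(0)
= 0 (theta_bot): contradiction. Case t > 0: LocalUniquenessCriterion gives eps > 0;
PercolationForcesLocalUniqueness gives mu_t^F(V_n) -> 1, so some n >= max(R,1) has mu_t^F(V_n) > 1 -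
eps/2 (Tendsto.eventually_const_lt, eventually_ge_atTop). WEAK CONTINUITY (helper, all d): for
measurable F local of range R and A determined by a finite set K of pairs, s |-> (map F
(bondPercolation (zdGraph d) s)).real A is continuous on [0,1] — (map F mu_s) A = mu_s(F^-1 A)
(Measure.map_apply; A measurable by DeterminedBy.measurableSet_of_fin -/
@[route_item "route-CriticalPhenomena-PercMonotoneFactors"]
def NoJumpOfLocalUniqueness : Prop :=
  PercolationForcesLocalUniqueness → LocalUniquenessCriterion → ClassNoJump

-- `NoJumpOfLocalUniqueness` holds: proved by `Summit.CriticalPhenomena.PercolationContinuityZ3.Theorems.NoJumpOfLocalUniqueness_proof` (its module imports this route file, so no `_holds` link can be stated here).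

/-- item stmt-CriticalPhenomena-18242 · support · rank 11 · closed · proved by Summit.CriticalPhenomena.PercolationContinuityZ3.Theorems.PercMonotoneFactorsClassNoJumpOfMesoscopic.classNoJumpOfMesoscopic_proof @ f5fa9107e126 (prover) · by planner
[support] glue of the MESOSCOPIC SPLIT of the deciding crux (BC2 redirect, strategist cstrat-4488):
MesoscopicGluing → MesoscopicDensity → ClassNoJump. PROVABLE NOW — closed sorry-free (axioms
propext, Classical.choice, Quot.sound) as Theorems.ClassNoJump_of_mesoscopic in the strategist's
Split.lean (evidence on this item and on stmt-CriticalPhenomena-4488; tree copy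
Summits/CriticalPhenomena/PercolationContinuityZ3/Cruxes/ClassNoJump/Lines/mesoscopic_split.lean); a
prover lands it verbatim under Theorems/PercMonotoneFactorsClassNoJumpSplit.lean and closes this
item with `theorem ClassNoJumpOfMesoscopic_proof : ClassNoJumpOfMesoscopic :=
ClassNoJump_of_mesoscopic`. Proof: deterministic CHAINING — between two n-far-connected u, u′ ∈ Λ_2n
run the unit-step staircase inside Λ_2n (staircase_exists); MesoscopicDensity gives an
n-far-connected representative of Λ_2n within m = ⌊√n⌋+1 of every staircase point; consecutive
representatives are within m+1+m ≤ 3m, so MesoscopicGluing joins them inside Λ_6n; transitivity of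
{· ↔ · in Λ_6n} (reach_of_staircase); density at v = 0 gives the existence half of V_n (m ≤ n for n
≥ 2): D_n ∩ G_n ⊆ V_n (VEvent_of_density_of_gluing). G_n is local (deter -/
@[route_item "route-CriticalPhenomena-PercMonotoneFactors"]
def ClassNoJumpOfMesoscopic : Prop :=
  MesoscopicGluing → MesoscopicDensity → ClassNoJump

-- `ClassNoJumpOfMesoscopic` holds: proved by `Summit.CriticalPhenomena.PercolationContinuityZ3.Theorems.PercMonotoneFactorsClassNoJumpOfMesoscopic.classNoJumpOfMesoscopic_proof` @ f5fa9107e126 (its module imports this route file, so no `_holds` link can be stated here).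

/-- item stmt-CriticalPhenomena-4494 · assembly · rank 1 · closed · proved by Summit.CriticalPhenomena.PercolationContinuityZ3.Theorems.percMonotoneFactorsAssembly_proof @ c81599e1f1bc (prover) · by planner
sources: Grimmett1999, FitznerVanDerHofstad2017
[assembly] ClassNoJump → PercolationContinuityZ3 (F = id). -/
@[route_item "route-CriticalPhenomena-PercMonotoneFactors"]
def Assembly : Prop :=
  ClassNoJump → PercolationContinuityZ3

-- `Assembly` holds: proved by `Summit.CriticalPhenomena.PercolationContinuityZ3.Theorems.percMonotoneFactorsAssembly_proof` @ c81599e1f1bc (its module imports this route file, so no `_holds` link can be stated here).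

/-! D-0027 §2.1 — DECIDING THEOREM (planner-authored via `route open/edit --closes-file`; by planner-rbadge-CriticalPhenomena-PercMonotoneF-bc0f35ea-g4-0 2026-08-15T16:11:55Z):
its hypotheses are this route's items and its conclusion the sub-problem Statement (glue_lint), and it elaborates with this file. -/

@[closes "route-CriticalPhenomena-PercMonotoneFactors"] theorem closes (h_ClassNoJump : ClassNoJump) : _root_.PercolationContinuityZ3 := by
  show Literature.Probability.Percolation.theta (Literature.Probability.LatticeModels.zdGraph 3)
      (0 : Literature.Probability.LatticeModels.Site 3)
      (Literature.Probability.Percolation.criticalProbI 3) = 0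
  have key := h_ClassNoJump 0 id measurable_id monotone_id rfl rfl (fun _ hω => hω)
    (fun _ _ => rfl)
    (fun _ _ e hloc => hloc e ⟨e.out.1, Sym2.out_fst_mem e, e.out.1, Sym2.out_fst_mem e,
      fun i => by simp⟩)
    (Literature.Probability.Percolation.criticalProbI 3)
    (fun s hs => by
      rw [MeasureTheory.Measure.map_id]
      exact Literature.Probability.Percolation.theta_eq_zero_of_lt_criticalProb_holds
        (Literature.Probability.LatticeModels.zdGraph 3) 0 s hs)
  rw [MeasureTheory.Measure.map_id] at key
  exact key

end Summit.CriticalPhenomena.PercolationContinuityZ3.Theses.PercMonotoneFactors
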